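import Summits.QuantumFields.YangMills.Theorems.BalabanUVNodesN15KingModelPauliLinksScaling
import Summits.QuantumFields.YangMills.Theorems.BalabanUVNodesN15KingModelLandauMagneticLength
import HarnessLib

/-!
# BalabanUVNodes ∕ N15 — THE KING-MODEL RUNG (PART Ϸ-g): THE COVARIANCE OF THE PAULI PAIR DECAYS ON THE CURVATURE LENGTH — Combes–Thomas (PART Ϳ-g's engine) at the fibre floor
# `κ = m² + c·min(sin²a, sin²b)`: `‖(−cΔ_W+m²)⁻¹(x,i;y,j)‖ ≤ (m² + c·t∕2)⁻¹·exp(−√(t∕(16(d+1)))·d(x,y))`, `t = min(sin²a,sin²b)`; massless `≤ (2∕(ct))·e^{−…}`; in King's units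
# (`c = η⁻²`, `a = αη`, `b = βη`) prefactor `≤ 3∕min(α²,β²)` and rate `≥ √(min(α²,β²)∕(24(d+1)))` per PHYSICAL distance — η-UNIFORM exponential decay, NE2's currency
# (Track A, DAG node N15 = NE2 «η-rates of the covariance pieces»; FAN-OUT v1.1 §N15 s3 «KING-MODEL RUNG … + what the curved case adds»; count-neutral)

HONEST FRAMING.  Count-neutral (cell `pub-ymgap`, seat `pub-ymgap-dag-n15-e` g48; `--supports stmt-QuantumFields-27247 --as helper` = K3ᴬ, KEY MAP v3).  King's fine covariance layer `−cΔ_U + m²`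
(Ͱ-a `covLapF`) at the constant Pauli pair on ONE finite torus per spacing; PART Ϳ-g's Combes–Thomas engine `norm_covLapF_inv_entry_le_exp_of_coercive` BY NAME at PART Ϸ-d's coercivity
constant, with PART Ϡ-k's admissible rate letters `magneticRate_sq`∕`magneticRate_admissible` BY NAME; [King1986] Lemma 4.5 (4.38) p.674 is the TEMPLATE of an η-uniform exponential bound
(here for the fine covariance at a curved background, not for King's `C^{(k)}`); [Balaban1985BackgroundPropagators] (3.39) p.397 the shape `|G(U)(x,y)| ≤ Ce^{−δ|x−y|}`.  NOT Bałaban's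
`G_k(U)` (no block term), NOT (3.42); NOT a node discharge (N15 of record untouched); nothing continuum-YM ∕ ℝ⁴ ∕ OS ∕ Clay.

THE RESULTS (`K` any period vector; `ν₀ ≠ ν₁`; `t := min(sin²a, sin²b)`; `d(x,y)` = tree `tdistT`, the periodic graph distance):
* §1 `min_sin_sq_le_one`, ★★★ **`norm_covLapF_pauliLink_inv_entry_le`** (`c > 0`, `m² ≥ 0`, `t > 0`: `‖G(x,i;y,j)‖ ≤ (m² + ct∕2)⁻¹·exp(−√(t∕(16(d+1)))·d(x,y))`),
  ★★ **`norm_covLapF_pauliLink_massless_inv_entry_le`** (`‖(−cΔ_W)⁻¹(x,i;y,j)‖ ≤ (2∕(ct))·exp(−√(t∕(16(d+1)))·d(x,y))`: decay over `≍ t^{−1∕2} = 1∕min(|sin a|,|sin b|)` lattice steps);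
* §2 IN KING's UNITS: ★ `sqrt_scaled_rate` (`√(t∕(16(d+1)))·d = √(η⁻²t∕(16(d+1)))·(η·d)`),
  ★★★ **`norm_covLapF_pauliLink_massless_inv_entry_le_physical`** (`α, β > 0`, `αη, βη ≤ 1`: `‖(−η⁻²Δ_W)⁻¹(x,i;y,j)‖ ≤ (3∕min(α²,β²))·exp(−√(min(α²,β²)∕(24(d+1)))·(η·d(x,y)))` —
  prefactor and rate independent of the spacing: η-UNIFORM EXPONENTIAL DECAY ON THE CURVATURE LENGTH `1∕min(α,β)`; compare PART Ϡ-k's abelian `|B|^{−1∕2}`).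
PRIOR TREE ART (by name): Ϸ-c (`pauliLink`, `pauliLink_mem_unitaryGroup`), Ϸ-d (`re_quadForm_covLapF_pauliLink_ge`, `min_sin_sq_pos`), Ϸ-f (`pauliScaled`, `pauliScaled_ge_uniform`), Ϳ-g
(`norm_covLapF_inv_entry_le_exp_of_coercive`), Ϡ-k (`magneticRate_sq`, `magneticRate_admissible`), `King1986.Torus.tdistT`∕`tdistT_nonneg`, Mathlib (`Real.exp_le_exp`, `Real.sqrt_le_sqrt`,
`Real.sin_sq_le_one`).  Dedup (rg at filing): basename 0 files; needles `norm_covLapF_pauliLink_inv_entry_le|_massless_inv_entry_le_physical|sqrt_scaled_rate` 0 tree files.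
Locators: [King1986] (4.4) p.670, Lemma 4.5 (4.38) p.674; [Balaban1985BackgroundPropagators] (3.23) p.394, (3.39) p.397.  0 `sorry`, 0 `def`.
-/

noncomputable section

open scoped BigOperators ComplexConjugate ComplexOrder
open Finset Matrix WithLp

namespace Summit.QuantumFields.YangMills.BalabanUVNodes.N15KingModelRung.ConstantCurvature

open Literature.MathematicalPhysics.QuantumFieldTheory.Balaban1983to89.B5Prop11Plancherel (Tor unitVec)
open Literature.MathematicalPhysics.QuantumFieldTheory.King1986.Torus (tdistT tdistT_nonneg)
open Summit.QuantumFields.YangMills.BalabanUVNodes.N15KingModelRung.Covariant (covLapF fib)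
open Summit.QuantumFields.YangMills.BalabanUVNodes.N15KingModelRung.Curvature (norm_covLapF_inv_entry_le_exp_of_coercive)
open Summit.QuantumFields.YangMills.BalabanUVNodes.N15KingModelRung.Landau (magneticRate_sq magneticRate_admissible)

variable {d : ℕ} (K : Fin (d + 1) → ℕ) [hK : ∀ μ, NeZero (K μ)]

/-! ## §1 Combes–Thomas at the fibre floor -/

section Lattice

omit hK in
/-- `min(sin²a, sin²b) ≤ 1`. [folklore] -/
theorem min_sin_sq_le_one (a b : ℝ) : min (Real.sin a ^ 2) (Real.sin b ^ 2) ≤ 1 := (min_le_left _ _).trans (Real.sin_sq_le_one a)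

/-- ★★★ **EXPONENTIAL DECAY OF THE PAULI PAIR's COVARIANCE** (`c > 0`, `m² ≥ 0`, `t = min(sin²a,sin²b) > 0`, `ν₀ ≠ ν₁`):
`‖(−cΔ_W+m²)⁻¹(x,i;y,j)‖ ≤ (m² + c·t∕2)⁻¹·exp(−√(t∕(16(d+1)))·d(x,y))` on every torus (Ϳ-g's Combes–Thomas engine at Ϸ-d's floor `m² + ct`, Ϡ-k's admissible rate `ρ ≤ ct∕8`).
[cite: King1986, (4.38) p.674, (4.4) p.670; Balaban1985BackgroundPropagators, (3.39) p.397] -/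
theorem norm_covLapF_pauliLink_inv_entry_le {c : ℝ} (hc : 0 < c) {m2 : ℝ} (hm : 0 ≤ m2) {a b : ℝ} (ht : 0 < min (Real.sin a ^ 2) (Real.sin b ^ 2))
    {ν₀ ν₁ : Fin (d + 1)} (hν : ν₀ ≠ ν₁) (x y : Tor K) (i j : Fin 2) :
    ‖(covLapF K c m2 (kingConstLink K (pauliLink (d := d) a b ν₀ ν₁)))⁻¹ (x, i) (y, j)‖
      ≤ (m2 + c * min (Real.sin a ^ 2) (Real.sin b ^ 2) / 2)⁻¹
        * Real.exp (-(Real.sqrt (min (Real.sin a ^ 2) (Real.sin b ^ 2) / (16 * ((d : ℝ) + 1))) * tdistT K x y)) := by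
  set t := min (Real.sin a ^ 2) (Real.sin b ^ 2) with htdef
  have ht1 : t ≤ 1 := min_sin_sq_le_one a b
  have hκ : 0 < m2 + c * t := by positivity
  have hcoer : ∀ v : Tor K × Fin 2 → ℂ, (m2 + c * t) * ∑ z, ‖fib K v z‖ ^ 2 ≤ RCLike.re (star v ⬝ᵥ (covLapF K c m2 (kingConstLink K (pauliLink (d := d) a b ν₀ ν₁)) *ᵥ v)) :=
    fun v => re_quadForm_covLapF_pauliLink_ge K hc.le m2 a b hν v
  obtain ⟨hδ0, -, -⟩ := magneticRate_sq (d := d) ht.le ht1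
  have hadm := magneticRate_admissible (d := d) hc.le ht.le ht1
  have hρ : 2 * ((d : ℝ) + 1) * c * (Real.cosh (Real.sqrt (t / (16 * ((d : ℝ) + 1)))) - 1) < m2 + c * t := by nlinarith
  have h := norm_covLapF_inv_entry_le_exp_of_coercive K hc.le m2 (kingConstLink_mem_unitaryGroup K (pauliLink_mem_unitaryGroup a b ν₀ ν₁)) hκ hcoer hδ0 hρ x y i j
  have hden : m2 + c * t / 2 ≤ m2 + c * t - 2 * ((d : ℝ) + 1) * c * (Real.cosh (Real.sqrt (t / (16 * ((d : ℝ) + 1)))) - 1) := by nlinarith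
  have hden0 : 0 < m2 + c * t / 2 := by positivity
  calc ‖(covLapF K c m2 (kingConstLink K (pauliLink (d := d) a b ν₀ ν₁)))⁻¹ (x, i) (y, j)‖
      ≤ Real.exp (-(Real.sqrt (t / (16 * ((d : ℝ) + 1))) * tdistT K x y)) / (m2 + c * t - 2 * ((d : ℝ) + 1) * c * (Real.cosh (Real.sqrt (t / (16 * ((d : ℝ) + 1)))) - 1)) := h
    _ ≤ Real.exp (-(Real.sqrt (t / (16 * ((d : ℝ) + 1))) * tdistT K x y)) / (m2 + c * t / 2) := div_le_div_of_nonneg_left (Real.exp_nonneg _) hden0 hden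
    _ = (m2 + c * t / 2)⁻¹ * Real.exp (-(Real.sqrt (t / (16 * ((d : ℝ) + 1))) * tdistT K x y)) := by rw [div_eq_inv_mul]

/-- ★★ **THE MASSLESS COVARIANCE DECAYS** (`c > 0`, `sin a·sin b ≠ 0`): `‖(−cΔ_W)⁻¹(x,i;y,j)‖ ≤ (2∕(c·t))·exp(−√(t∕(16(d+1)))·d(x,y))`, `t = min(sin²a,sin²b)` — the curvature sets
both the amplitude and the decay length `≍ t^{−1∕2}` lattice steps. [cite: King1986, (4.38) p.674; Balaban1985BackgroundPropagators, (3.39) p.397] -/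
theorem norm_covLapF_pauliLink_massless_inv_entry_le {c : ℝ} (hc : 0 < c) {a b : ℝ} (ha : Real.sin a ≠ 0) (hb : Real.sin b ≠ 0) {ν₀ ν₁ : Fin (d + 1)} (hν : ν₀ ≠ ν₁)
    (x y : Tor K) (i j : Fin 2) :
    ‖(covLapF K c 0 (kingConstLink K (pauliLink (d := d) a b ν₀ ν₁)))⁻¹ (x, i) (y, j)‖
      ≤ 2 / (c * min (Real.sin a ^ 2) (Real.sin b ^ 2))
        * Real.exp (-(Real.sqrt (min (Real.sin a ^ 2) (Real.sin b ^ 2) / (16 * ((d : ℝ) + 1))) * tdistT K x y)) := by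
  have ht := min_sin_sq_pos ha hb
  have h := norm_covLapF_pauliLink_inv_entry_le K hc le_rfl ht hν x y i j
  have heq : ((0 : ℝ) + c * min (Real.sin a ^ 2) (Real.sin b ^ 2) / 2)⁻¹ = 2 / (c * min (Real.sin a ^ 2) (Real.sin b ^ 2)) := by
    rw [zero_add, inv_eq_one_div, div_div_eq_mul_div, one_mul]
  rwa [heq] at h

end Lattice

/-! ## §2 In King's units: η-uniform decay on the curvature length -/

section Physical

omit hK in
/-- ★ UNITS: `√(t∕(16(d+1)))·D = √(η⁻²t∕(16(d+1)))·(η·D)` for `η > 0`, `t ≥ 0`. [folklore] -/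
theorem sqrt_scaled_rate {η t D : ℝ} (hη : 0 < η) (ht : 0 ≤ t) :
    Real.sqrt (t / (16 * ((d : ℝ) + 1))) * D = Real.sqrt (η⁻¹ ^ 2 * t / (16 * ((d : ℝ) + 1))) * (η * D) := by
  have hpos : (0 : ℝ) ≤ 16 * ((d : ℝ) + 1) := by positivity
  have h1 : η⁻¹ ^ 2 * t / (16 * ((d : ℝ) + 1)) = (η⁻¹) ^ 2 * (t / (16 * ((d : ℝ) + 1))) := by ring
  rw [h1, Real.sqrt_mul' _ (div_nonneg ht hpos), Real.sqrt_sq (inv_nonneg.mpr hη.le)]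
  field_simp

/-- ★★★ **η-UNIFORM EXPONENTIAL DECAY ON THE CURVATURE LENGTH** (King's units `c = η⁻²`, `a = αη`, `b = βη`; `α, β > 0`, `αη, βη ≤ 1`): for the MASSLESS covariance of the Pauli pair
`‖(−η⁻²Δ_W)⁻¹(x,i;y,j)‖ ≤ (3∕min(α²,β²))·exp(−√(min(α²,β²)∕(24(d+1)))·(η·d(x,y)))` — `η·d(x,y)` is the physical distance; neither the prefactor nor the rate sees the spacing.
[cite: King1986, Lemma 4.5 (4.38) p.674, (4.4) p.670; Balaban1985BackgroundPropagators, (3.39) p.397] -/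
theorem norm_covLapF_pauliLink_massless_inv_entry_le_physical {η α β : ℝ} (hη : 0 < η) (hα : 0 < α) (hβ : 0 < β) (ha : α * η ≤ 1) (hb : β * η ≤ 1)
    {ν₀ ν₁ : Fin (d + 1)} (hν : ν₀ ≠ ν₁) (x y : Tor K) (i j : Fin 2) :
    ‖(covLapF K (η⁻¹ ^ 2) 0 (kingConstLink K (pauliLink (d := d) (α * η) (β * η) ν₀ ν₁)))⁻¹ (x, i) (y, j)‖
      ≤ 3 / min (α ^ 2) (β ^ 2) * Real.exp (-(Real.sqrt (min (α ^ 2) (β ^ 2) / (24 * ((d : ℝ) + 1))) * (η * tdistT K x y))) := by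
  set t := min (Real.sin (α * η) ^ 2) (Real.sin (β * η) ^ 2) with htdef
  set m := min (α ^ 2) (β ^ 2) with hmdef
  have hm0 : 0 < m := lt_min (by positivity) (by positivity)
  -- the physical floor `η⁻²t = pauliScaled ≥ ⅔m`
  have hfloor : 2 / 3 * m ≤ η⁻¹ ^ 2 * t := pauliScaled_ge_uniform hα.le hβ.le hη ha hb
  have ht0 : 0 < t := by
    have : 0 < η⁻¹ ^ 2 * t := lt_of_lt_of_le (by positivity) hfloor
    exact pos_of_mul_pos_right this (by positivity)
  have hsa : Real.sin (α * η) ≠ 0 := fun h => by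
    have : t ≤ 0 := by rw [htdef, h]; simp [sq_nonneg]
    linarith
  have hsb : Real.sin (β * η) ≠ 0 := fun h => by
    have : t ≤ 0 := by rw [htdef, h]; simp [sq_nonneg]
    linarith
  have h := norm_covLapF_pauliLink_massless_inv_entry_le K (by positivity : (0 : ℝ) < η⁻¹ ^ 2) hsa hsb hν x y i j
  -- prefactor: `2∕(η⁻²t) ≤ 3∕m`
  have hpre : 2 / (η⁻¹ ^ 2 * t) ≤ 3 / m := by
    rw [div_le_div_iff₀ (by positivity) hm0]; nlinarith
  -- rate: `√(t∕(16(d+1)))·d = √(η⁻²t∕(16(d+1)))·(η·d) ≥ √(m∕(24(d+1)))·(η·d)`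
  have hrate : Real.sqrt (m / (24 * ((d : ℝ) + 1))) ≤ Real.sqrt (η⁻¹ ^ 2 * t / (16 * ((d : ℝ) + 1))) := by
    refine Real.sqrt_le_sqrt ?_
    rw [div_le_div_iff₀ (by positivity) (by positivity)]
    nlinarith [hfloor, (by positivity : (0 : ℝ) < (d : ℝ) + 1)]
  have hexp : Real.exp (-(Real.sqrt (t / (16 * ((d : ℝ) + 1))) * tdistT K x y))
      ≤ Real.exp (-(Real.sqrt (m / (24 * ((d : ℝ) + 1))) * (η * tdistT K x y))) := by
    rw [sqrt_scaled_rate (d := d) hη ht0.le]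
    exact Real.exp_le_exp.mpr (by nlinarith [mul_nonneg hη.le (tdistT_nonneg K x y), mul_le_mul_of_nonneg_right hrate (mul_nonneg hη.le (tdistT_nonneg K x y))])
  calc ‖(covLapF K (η⁻¹ ^ 2) 0 (kingConstLink K (pauliLink (d := d) (α * η) (β * η) ν₀ ν₁)))⁻¹ (x, i) (y, j)‖
      ≤ 2 / (η⁻¹ ^ 2 * t) * Real.exp (-(Real.sqrt (t / (16 * ((d : ℝ) + 1))) * tdistT K x y)) := h
    _ ≤ 3 / m * Real.exp (-(Real.sqrt (m / (24 * ((d : ℝ) + 1))) * (η * tdistT K x y))) :=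
        mul_le_mul hpre hexp (Real.exp_nonneg _) (by positivity)

end Physical

end Summit.QuantumFields.YangMills.BalabanUVNodes.N15KingModelRung.ConstantCurvature

end
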